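import Summits.QuantumFields.YangMills.Theorems.BalabanUVNodesK0TwoPrimeOfFixedRadiusBoxThm1Slots
import Summits.QuantumFields.YangMills.Theorems.BalabanUVNodesN09MembershipDomainOpenOfBerge

/-!
# K0⁷ — THE №432 DOOR WITH ITS DOMAIN SYSTEM PINNED: `U := Node00.domUOfRecord` (N09's MEMBERSHIP DOMAIN OF RECORD), OPENNESS DISCHARGED IN RANGE BY BERGE (dag-n09-w1 g8),
# THE FIRST-FORM SANDWICH GONE — «2′ ⟸ box at ONE radius ā + {hT1, hUk, h11, (I)} + Lipschitz collar + continuity + upward (8)-row + numerics»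

Cell `pub-ymgap`, width seat `pub-ymgap-dag-n07-w3` (g20; N07 [B11] ∕ K0⁷ junction).  `--kind proof --supports stmt-QuantumFields-20541 --as helper`, COUNT-NEUTRAL.  NEW leaf;
theorems only — 0 `def`, 0 `sorry`, 0 `instance`, 0 `notation`.  Imports this seat's `…K0TwoPrimeOfFixedRadiusBoxThm1Slots` (g20 file 1: rows (hU1)(hR)(hQ) from the standard slots;
it carries g19's door chain `…K0TwoPrimeOfFixedRadiusBox` ⟵ `…K0Beta13RadiusBlindFirstForm` ⟵ `…K0Beta13RadiusBlind`) and dag-n09-w1 g8's `…N09MembershipDomainOpenOfBerge`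
(`isOpen_domUOfRecord_of_interior_of_uniqIn`: the membership domain `Node00.domUOfRecord ν εbg ρ K k` IS OPEN from N07's interiority sentence (I) + [B11] Thm 1 (6) uniqueness on
`PlaqSmall 2ρ` + numerics, by Berge's maximum theorem — `Literature.Topology.MaximumTheoremMovingConstraint`).  [I] = [Balaban1987RG1]; [15] = [Balaban1985Variational]; [B7] = [Balaban1985Averaging].

WHY.  After file 1 the door «2′ ⟸ box at ONE radius ā» still asked the producer for an abstract OPEN domain system `U` squeezed onto the first form by (hsub)(hsup) — openness of the first
form being [15] §F species («continuity of `V ↦ U_k(V)`»), proved nowhere.  But the first form of radius `ā` and membership radius `ρ` IS, under the level-wise uniqueness slot `h11` and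
[B7] (53), N09's MEMBERSHIP DOMAIN OF RECORD `Node00.domUOfRecord ν ā ρ K k = {V | |∂V − 1| < ν.ε₀ ∧ UkExists ā V ∧ UniqueUkOrbit ā V ∧ U_k(ā; V) ∈ bgReg_k(ρ)}` at any threshold
`ν.ε₀ ≥ 2ρ` (§2: `firstForm_of_mem_domU` ∕ `mem_domU_of_firstForm`), and dag-n09-w1 g8 proved that domain OPEN at every level `k ≤ m + K` from (I) + uniqueness + numerics.  The read-set
induction of g19's `…K0Beta13RadiusBlind.betaOfRecord₁₃_thm1CCMWZB_radiusBlind_of_readSet` reads its domain system only at levels `k + 1 ≤ K` (every use of `hUo`, `hU1`, `hU`, `hC`,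
`hN`, `hB` sits under `k < K`), so the family `Û K k := if k ≤ K then domUOfRecord … K k else univ` (open everywhere, `1 ∈ Û`) carries the induction — §3.  RESULT: the door's domain
system is no longer producer data; its openness is no longer a row; the first-form sandwich disappears; and INSIDE Theorem 1's window (`a₀ ≤ α₀`) the selector's upward (8)-row is
FREE as well (§2 `ukExists_and_regular_up_of_slots`).  What the producer still owes per text radius `a₀`: numerics on `ρ`, NODE O's box at `ā`, the Lipschitz-(8) collar row (hS) ON THE
FIRST FORM, the continuity row (hT) ON THE PLAQUETTE BALL `PlaqSmall δ₁₁` (= N09's analytic-inclusion species `hreg : domAlt ⊆ regSetOfRecord`, K0e ∕ [I] p. 259, at threshold `δ₁₁`),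
and — only for text radii BEYOND the ceiling, `a₀ > α₀`, where the text's [15] antecedent is nobody's theorem — the upward (8)-row on the first form.  Door level: `hT1`, `hUk`, `h11`, (I) —
N07's four standard displayed sentences, the same N09 displays (`hUk`∕`h11` at every radius `ε ∈ [ā, α₀]`) — and numerics on `ā` (`ā < α`, [B7] rows + loop guards at `α`: Berge's window).

CONTENTS.  §1 letter bookkeeping at `d = 4` (`((d+2)L)²∕4 = 9L²`, `L^{d−1} = L³`, `L^k·η_k = 1`).  §2 (generic rank `N`, any threshold carrier `ν`): ★ `firstForm_of_mem_domU`,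
`plaqSmall_two_mul_of_firstForm` (a first-form field is `2ρ`-plaquette-small, [B7] (53)), ★ `mem_domU_of_firstForm` (`2ρ ≤ ν.ε₀`, (53) at `ρ`, `h11` on `PlaqSmall ν.ε₀`),
★ `ukExists_and_regular_up_of_slots` (the selector's UPWARD (8)-row is FREE inside Theorem 1's window `a ≤ a′ ≤ α₀`: existence ∧ uniqueness at `a′` from `h11`, `a`-regularity of the
radius-`a′` minimisers from dag-n21-c's (8)→(9) transfer), `one_mem_domU`, ★ `isOpen_domU_of_slots` (dag-n09-w1 g8 in `K`-free letters), ★ `iter_Uk_mem_domU` (row (hB) ON `domU` from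
file 1's `isBackground_restrict_and_uniqueUkOrbit_of_slots`), `Uk_eq_of_mem_domU_of_le` (selector agreement downward ON `domU`).  §3 ★★★ `absBetaBoxGZBAt_of_boxAtRadius_of_membershipDomain`
(`N = 2`; slots `hUk`∕`h11` displayed at every radius `ε ∈ [ā, α₀]`; selector alternative «down ∨ up-inside-the-window ∨ (8)-row beyond the ceiling»): the door, composed BY NAME with g19's
`_of_readSet` on `Û` and the letter census.  §4 A6: `openNumerics_inhabited` (the `ā`-window is an inhabited range).

HONEST FRAMING (binding).  A by-name composition; NO β estimate; nothing of Bałaban's asserted.  DISPLAYED: `hT1` (Theorem 1 at objects; levels `k ≥ 1` = Bałaban's theorem, proved NOWHERE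
in the tree), `hUk` (₈a rows at `ā`), `h11` ([I] (1.1) on `PlaqSmall δ₁₁`), (I) = N07's INTERIORITY sentence («every minimiser over `closure (bgReg ā) ∩ 𝔅_k(V)` lies in `bgReg ā`»,
[15] Prop. 7 ∕ §F species; `…N07DirectMethodInduction`'s `hint`), NODE O's box at `ā` ([I] Thm 3 β-clause p. 264 — print-proved (claimed), UNPORTED), the Lipschitz collar (hS) ([15] §F,
NOT in the tree), the continuity row (hT) (row P7 ∕ K0e `hreg` species), the upward (8)-row, numerics.  None is discharged here.  Stub 2′ OPEN; K0⁷ stmt-QuantumFields-20541 NOT closed; N07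
NOT discharged; COUNT 8∕28 · K 1∕4 UNMOVED; R4 = the CONDITIONAL finite-𝕋⁴ rung `BalabanLadder.UV` at fixed `ε = L^(−K)` only — NOT continuum ∕ ℝ⁴ ∕ OS; the Yang–Mills mass gap
(Clay) is NOT proved by any of this.  Standard axioms only.
-/

noncomputable section

open MeasureTheory Set Filter Topology
open scoped Matrix.Norms.L2Operator

namespace Summit.QuantumFields.YangMills.BalabanUVNodes.K0TwoPrimeOfMembershipDomain

open Literature.MathematicalPhysics.QuantumFieldTheory.Balaban1983to89
open Literature.MathematicalPhysics.QuantumFieldTheory.Balaban1983to89.Node00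
open Literature.MathematicalPhysics.QuantumFieldTheory.Balaban1983to89.T4Continuum
open Literature.MathematicalPhysics.QuantumFieldTheory.Balaban1983to89.FlowStep
open Literature.MathematicalPhysics.QuantumFieldTheory.Balaban1983to89.B15DeterminingSets
open Literature.MathematicalPhysics.QuantumFieldTheory.Balaban1983to89.ExpMeanLog (deltaSU deltaSU_pos)
open Literature.MathematicalPhysics.QuantumFieldTheory.Balaban1983to89.B12GaugeOrbits021 (OrbitRel)
open B12Eq019ActionBody (integrand)
open Summit.QuantumFields.YangMills.Theorems.K0V23Defs (AbsBetaBoxAtThm1WitnessCCMGenGridGZBAt)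
open Summit.QuantumFields.YangMills.BalabanUVNodes.K0Beta13RadiusBlind (betaOfRecord₁₃_thm1CCMWZB_radiusBlind_of_readSet)
open Summit.QuantumFields.YangMills.BalabanUVNodes.K0Beta13RadiusBlindFirstForm (Uk_eq_of_le_of_forall_isBackground_mem bgReg_succ_subset)
open Summit.QuantumFields.YangMills.BalabanUVNodes.N09BackgroundRadiiTransfer (bgReg_mono mem_bgReg_iff_of_orbitRel)
open Summit.QuantumFields.YangMills.Theorems.N21AveragedDatumRegularity (plaqSmall_iter_avOfRecord_level)
open Summit.QuantumFields.YangMills.Theorems.N21RegularityTransferJunction (plaqSmall_Uk_of_thm1_objects)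
open Summit.QuantumFields.YangMills.BalabanUVNodes.N09MembershipDomainOpenOfBerge (isOpen_domUOfRecord_of_interior_of_uniqIn)
open Summit.QuantumFields.YangMills.BalabanUVNodes.K0TwoPrimeOfFixedRadiusBoxThm1Slots (h53a_at h53b_at one_mem_firstForm isBackground_restrict_and_uniqueUkOrbit_of_slots
  slotNumerics_inhabited)

/-! ## §1  Letter bookkeeping at `d = 4` -/

section Letters

variable {F : T4Family}

/-- `((d+2)L)²∕4 = 9L²` at the record (`d = 4`). [cite: Balaban1987RG1, (0.1) p.251 (bookkeeping)] -/
theorem cast_d_add_two_mul_L_sq_div_four (K : ℕ) : ((((F.P K).d + 2) * (F.P K).L : ℕ) : ℝ) ^ 2 / 4 = 9 * (F.L : ℝ) ^ 2 := by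
  rw [T4Family.P_d, T4Family.P_L]; push_cast; ring

/-- `L^{d−1} = L³` at the record. [cite: Balaban1987RG1, (0.1) p.251 (bookkeeping)] -/
theorem cast_L_pow_d_sub_one (K : ℕ) : ((F.P K).L : ℝ) ^ ((F.P K).d - 1) = (F.L : ℝ) ^ 3 := by
  rw [T4Family.P_d, T4Family.P_L]

/-- `L^k · η_k = 1`. [cite: Balaban1987RG1, (1.1)–(1.2) p.260 (bookkeeping)] -/
theorem pow_mul_eta_self (K k : ℕ) : ((F.P K).L : ℝ) ^ k * (F.P K).eta k = 1 := by
  have hL : ((F.P K).L : ℝ) ≠ 0 := by exact_mod_cast (F.P K).L_pos.ne'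
  rw [Params.eta, ← mul_pow, mul_inv_cancel₀ hL, one_pow]

end Letters

/-! ## §2  The first form IS the membership domain of record; openness in range; rows (hB) and selector-down ON the domain -/

section Domain

variable {F : T4Family} {N : ℕ} [NeZero N]

/-- ★ **A MEMBER OF THE MEMBERSHIP DOMAIN IS IN THE FIRST FORM**: `V ∈ domU(ν; a, ρ)` ⟹ the radius-`a` problem at `V` is solvable and EVERY radius-`a` minimiser over `V` is `ρ·η_k²`-regular
(the chosen one is, by membership; the others are its residual transforms, by the uniqueness conjunct; plaquette smallness is orbit-constant). [cite: Balaban1987RG1, (1.1)–(1.2) p.260; Balaban1985Variational, Thm 1 (6) p.279 (bookkeeping)] -/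
theorem firstForm_of_mem_domU {ν : Stage7Numerics} {a ρ : ℝ} {K k : ℕ} {V : GaugeField (F.P K) k (SU N)} (hV : V ∈ domUOfRecord F N ν a ρ K k) :
    UkExists F N K k a V ∧ ∀ U₁, IsBackground (avOfRecord F N K) (bgReg F N K k a) k V U₁ → U₁ ∈ bgReg F N K k ρ := by
  obtain ⟨-, hex, hun, hmem⟩ := (mem_domUOfRecord_iff ν a ρ K k V).1 hV
  exact ⟨hex, fun U₁ h₁ => (mem_bgReg_iff_of_orbitRel (hun _ _ (isBackground_Uk hex) h₁)).1 hmem⟩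

/-- ★ **A FIRST-FORM FIELD IS IN THE MEMBERSHIP DOMAIN** (threshold `ν.ε₀ ≥ 2ρ`; (53) numerics at `ρ`; the level-`k` slot `h11` on `PlaqSmall ν.ε₀`): its chosen minimiser is `ρ·η_k²`-regular,
so `V = Ū^k(U_k(a;V))` is `2ρ`-plaquette-small ([B7] (53), dag-n21-c), hence in the threshold ball, where `h11` gives the uniqueness conjunct. [cite: Balaban1985Averaging, Prop. 2 (53) p.26; Balaban1987RG1, (1.1)–(1.2) p.260 and p.259] -/
theorem plaqSmall_two_mul_of_firstForm {a ρ : ℝ} {K k : ℕ} (hρ : 0 < ρ) (h53a : 143 * 256 * ρ ≤ 1 / 3)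
    (h53b : 2 * ρ ≤ 2 * deltaSU (Fin N) / (8 * (F.L : ℝ)) ^ 2)
    {V : GaugeField (F.P K) k (SU N)} (hV : UkExists F N K k a V ∧ ∀ U₁, IsBackground (avOfRecord F N K) (bgReg F N K k a) k V U₁ → U₁ ∈ bgReg F N K k ρ) :
    PlaqSmall (2 * ρ) V := by
  obtain ⟨hex, hreg⟩ := hV
  have h := plaqSmall_iter_avOfRecord_level K k hρ (h53a_at K h53a) (h53b_at K h53b) ((mem_bgReg_iff F N K k ρ _).1 (hreg _ (isBackground_Uk hex))) le_rfl
  rw [pow_mul_eta_self, iter_Uk hex] at h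
  simpa using h

/-- ★ **A FIRST-FORM FIELD IS IN THE MEMBERSHIP DOMAIN** (threshold `ν.ε₀ ≥ 2ρ`; (53) numerics at `ρ`; the level-`k` slot `h11` on `PlaqSmall ν.ε₀`): by `plaqSmall_two_mul_of_firstForm` the field is in the
threshold ball, where `h11` gives the uniqueness conjunct; the membership conjunct is the first form read at the chosen minimiser. [cite: Balaban1985Averaging, Prop. 2 (53) p.26; Balaban1987RG1, (1.1)–(1.2) p.260 and p.259] -/
theorem mem_domU_of_firstForm {ν : Stage7Numerics} {a ρ : ℝ} {K k : ℕ} (hρ : 0 < ρ) (h53a : 143 * 256 * ρ ≤ 1 / 3)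
    (h53b : 2 * ρ ≤ 2 * deltaSU (Fin N) / (8 * (F.L : ℝ)) ^ 2) (hδ : 2 * ρ ≤ ν.ε₀)
    (h11 : ∀ V : GaugeField (F.P K) k (SU N), PlaqSmall ν.ε₀ V → UkExists F N K k a V ∧ UniqueUkOrbit F N K k a V)
    {V : GaugeField (F.P K) k (SU N)} (hV : UkExists F N K k a V ∧ ∀ U₁, IsBackground (avOfRecord F N K) (bgReg F N K k a) k V U₁ → U₁ ∈ bgReg F N K k ρ) :
    V ∈ domUOfRecord F N ν a ρ K k := by
  have hA : PlaqSmall ν.ε₀ V := fun p => (plaqSmall_two_mul_of_firstForm hρ h53a h53b hV p).trans_le hδ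
  exact (mem_domUOfRecord_iff ν a ρ K k V).2 ⟨hA, hV.1, (h11 V hA).2, hV.2 _ (isBackground_Uk hV.1)⟩

/-- ★ **THE SELECTOR's UPWARD (8)-ROW FROM THE SLOTS INSIDE THEOREM 1's WINDOW** (`a ≤ a′ ≤ α₀`): at a first-form field `W` of radius `a` and membership `ρ` (so `|∂W − 1| < 2ρ`), the radius-`a′`
problem is solvable and EVERY radius-`a′` minimiser is `a`-regular — existence and uniqueness at radius `a′` from `h11` (at `a′`, on `PlaqSmall δ₁₁ ∋ W`), the regularity of the chosen radius-`a′`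
minimiser from dag-n21-c's (8)→(9) transfer (`hT1` + ₈a's rows at `a′`; `δ := 2ρ ≤ α₁`, `2Bρ ≤ a ≤ a′`), moved to every minimiser along the residual orbit.  So inside the window the radius letter is
FREE upward as well; only text radii beyond the ceiling `α₀` keep a displayed (8)-row. CONDITIONAL on the slots; nothing of Bałaban's asserted.
[cite: Balaban1985Variational, Thm 1 (6),(8)–(9) p.279; Balaban1987RG1, (1.1)–(1.2) p.260; Balaban1985Averaging, Prop. 2 (53) p.26] -/
theorem ukExists_and_regular_up_of_slots (K k : ℕ) {a a' ρ δ₁₁ α₀ α₁ B : ℝ} (hle : a ≤ a') (ha'α : a' ≤ α₀) (hρ : 0 < ρ)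
    (h53a : 143 * 256 * ρ ≤ 1 / 3) (h53b : 2 * ρ ≤ 2 * deltaSU (Fin N) / (8 * (F.L : ℝ)) ^ 2)
    (hδ : 2 * ρ ≤ δ₁₁) (hα₁ : 2 * ρ ≤ α₁) (hBρ : 2 * B * ρ ≤ a)
    (hT1 : ∀ ε₁ : ℝ, 0 < ε₁ → ε₁ ≤ α₁ → ∀ V : GaugeField (F.P K) k (SU N), PlaqSmall ε₁ V →
      (∃ U : GaugeField (F.P K) 0 (SU N), IsBackground (avOfRecord F N K) {U | InUkClassB11 F N K k (B * ε₁) U} k V U) ∧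
      (∀ ε₀ : ℝ, B * ε₁ ≤ ε₀ → ε₀ ≤ α₀ → ∀ U U' : GaugeField (F.P K) 0 (SU N),
          IsBackground (avOfRecord F N K) {U | InUkClassB11 F N K k (B * ε₁) U} k V U →
          IsBackground (avOfRecord F N K) {U | InUkClassB11 F N K k ε₀ U} k V U' → InUkClassB11 F N K k ε₀ U ∧ OrbitRel k U U'))
    (hUk' : ∀ (V : GaugeField (F.P K) k (SU N)) (δ : ℝ), 0 < δ → δ ≤ α₁ → B * δ ≤ a' → PlaqSmall δ V →
      UkExists F N K k a' V ∧ InUkClassB11 F N K k a' (Uk F N K k a' V))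
    (h11' : ∀ V : GaugeField (F.P K) k (SU N), PlaqSmall δ₁₁ V → UkExists F N K k a' V ∧ UniqueUkOrbit F N K k a' V)
    {W : GaugeField (F.P K) k (SU N)} (hW : UkExists F N K k a W ∧ ∀ U₁, IsBackground (avOfRecord F N K) (bgReg F N K k a) k W U₁ → U₁ ∈ bgReg F N K k ρ) :
    UkExists F N K k a' W ∧ ∀ U₁, IsBackground (avOfRecord F N K) (bgReg F N K k a') k W U₁ → U₁ ∈ bgReg F N K k a := by
  have h2 : PlaqSmall (2 * ρ) W := plaqSmall_two_mul_of_firstForm hρ h53a h53b hW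
  obtain ⟨hex', hun'⟩ := h11' W fun p => (h2 p).trans_le hδ
  have hδpos : 0 < 2 * ρ := by positivity
  have hBa : B * (2 * ρ) ≤ a := by linarith [show B * (2 * ρ) = 2 * B * ρ by ring]
  have hBδ : B * (2 * ρ) ≤ a' := hBa.trans hle
  have h8 : PlaqSmall (B * (2 * ρ) * (F.P K).eta k ^ 2) (Uk F N K k a' W) := plaqSmall_Uk_of_thm1_objects hT1 hUk' ha'α hδpos hα₁ hBδ h2
  have hmem : Uk F N K k a' W ∈ bgReg F N K k a := by
    rw [mem_bgReg_iff]
    exact fun p => (h8 p).trans_le (mul_le_mul_of_nonneg_right hBa (sq_nonneg _))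
  exact ⟨hex', fun U₁ h₁ => (mem_bgReg_iff_of_orbitRel (hun' _ _ (isBackground_Uk hex') h₁)).1 hmem⟩

/-- **The flat datum is a member** (`a, ρ > 0`, `2ρ ≤ ν.ε₀`; file 1's `one_mem_firstForm` through `mem_domU_of_firstForm`). [cite: Balaban1985Variational, Thm 1 p.279 and (4) p.278; Balaban1987RG1, (1.2) p.260] -/
theorem one_mem_domU {ν : Stage7Numerics} {a ρ : ℝ} (K k : ℕ) (ha : 0 < a) (hρ : 0 < ρ) (h53a : 143 * 256 * ρ ≤ 1 / 3)
    (h53b : 2 * ρ ≤ 2 * deltaSU (Fin N) / (8 * (F.L : ℝ)) ^ 2) (hδ : 2 * ρ ≤ ν.ε₀)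
    (h11 : ∀ V : GaugeField (F.P K) k (SU N), PlaqSmall ν.ε₀ V → UkExists F N K k a V ∧ UniqueUkOrbit F N K k a V) :
    (1 : GaugeField (F.P K) k (SU N)) ∈ domUOfRecord F N ν a ρ K k :=
  mem_domU_of_firstForm hρ h53a h53b hδ h11 (one_mem_firstForm K k ha hρ)

/-- ★ **THE MEMBERSHIP DOMAIN IS OPEN IN RANGE** (`k ≤ m + K`) — dag-n09-w1 g8's `isOpen_domUOfRecord_of_interior_of_uniqIn` in `K`-free letters (`d = 4`): radius `a < α` with the [B7] rows
and the two loop guards at `α` (Berge's compactness window), (53) at `ρ`, `2ρ ≤ ν.ε₀`; N07's INTERIORITY sentence (I) and the uniqueness half of `h11`, both on the threshold ball `PlaqSmall ν.ε₀`.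
CONDITIONAL on (I) and `h11`; nothing of Bałaban's asserted. [cite: Balaban1985Variational, Thm 1 (6), (8) p.279, Prop. 7 p.299; Balaban1987RG1, (1.1)–(1.2) p.260, p.259; Balaban1985Averaging, Prop. 2 (53)–(54) p.26] -/
theorem isOpen_domU_of_slots {ν : Stage7Numerics} (K k : ℕ) (hk : k ≤ F.m + K) {a ρ α : ℝ} (haα : a < α) (hα : 0 < α)
    (hα3 : 143 * 256 * α ≤ 1 / 3) (hα2 : 2 * α ≤ 2 * deltaSU (Fin N) / (8 * (F.L : ℝ)) ^ 2)
    (hα24 : 9 * (F.L : ℝ) ^ 2 * (2 * α) ≤ 1 / 24) (hαL : 157 * (9 * (F.L : ℝ) ^ 2 * (2 * α)) < ((F.L : ℝ) ^ 3)⁻¹)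
    (hρ : 0 < ρ) (h53a : 143 * 256 * ρ ≤ 1 / 3) (h53b : 2 * ρ ≤ 2 * deltaSU (Fin N) / (8 * (F.L : ℝ)) ^ 2) (hδ : 2 * ρ ≤ ν.ε₀)
    (hI : ∀ V : GaugeField (F.P K) k (SU N), PlaqSmall ν.ε₀ V → ∀ U₀ : GaugeField (F.P K) 0 (SU N),
      IsBackground (avOfRecord F N K) (closure (bgReg F N K k a)) k V U₀ → U₀ ∈ bgReg F N K k a)
    (h11u : ∀ V : GaugeField (F.P K) k (SU N), PlaqSmall ν.ε₀ V → UniqueUkOrbit F N K k a V) :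
    IsOpen (domUOfRecord F N ν a ρ K k) :=
  isOpen_domUOfRecord_of_interior_of_uniqIn ν K k haα hα (h53a_at K hα3) (h53b_at K hα2)
    (by rw [cast_d_add_two_mul_L_sq_div_four]; exact hα24) (by rw [cast_d_add_two_mul_L_sq_div_four, cast_L_pow_d_sub_one]; exact hαL)
    (by rw [T4Family.P_m, T4Family.P_K]; exact hk) hρ (h53a_at K h53a) (h53b_at K h53b)
    (fun V hV => hI V ((mem_domUOfRecord_iff ν a ρ K k V).1 hV).1) (fun V hV => h11u V fun p => (hV p).trans_le hδ)

/-- ★ **ROW (hB) ON THE MEMBERSHIP DOMAIN**: for a member `W` of level `k+1`, the averaged background `Ū^k(U_{k+1}(a; W))` is a member of level `k` — file 1's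
`isBackground_restrict_and_uniqueUkOrbit_of_slots` ((hR)+(hQ) from `hT1`∕`hUk`∕`h11` + numerics) puts it in the first form of level `k` (restriction gives solvability with the `ρ·η_{k+1}² ≤ ρ·η_k²`-regular
witness, uniqueness moves that regularity to every minimiser), then `mem_domU_of_firstForm`. [cite: Balaban1987RG1, (1.1)–(1.2) p.260, p.259; Balaban1985Variational, Thm 1 (6),(8)–(10) p.279; Balaban1985Averaging, Prop. 2 (53) p.26] -/
theorem iter_Uk_mem_domU {ν : Stage7Numerics} (K k : ℕ) {a ρ α₀ α₁ B : ℝ} (ha : 0 < a) (haα : a ≤ α₀) (hρ : 0 < ρ)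
    (h53a : 143 * 256 * ρ ≤ 1 / 3) (h53b : 2 * ρ ≤ 2 * deltaSU (Fin N) / (8 * (F.L : ℝ)) ^ 2)
    (hδ : 2 * ρ ≤ ν.ε₀) (hα₁ : 2 * ρ ≤ α₁) (hB : 0 ≤ B) (hBρ : 2 * B * ρ ≤ a)
    (hT1 : ∀ ε₁ : ℝ, 0 < ε₁ → ε₁ ≤ α₁ → ∀ V : GaugeField (F.P K) k (SU N), PlaqSmall ε₁ V →
      (∃ U : GaugeField (F.P K) 0 (SU N), IsBackground (avOfRecord F N K) {U | InUkClassB11 F N K k (B * ε₁) U} k V U) ∧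
      (∀ ε₀ : ℝ, B * ε₁ ≤ ε₀ → ε₀ ≤ α₀ → ∀ U U' : GaugeField (F.P K) 0 (SU N),
          IsBackground (avOfRecord F N K) {U | InUkClassB11 F N K k (B * ε₁) U} k V U →
          IsBackground (avOfRecord F N K) {U | InUkClassB11 F N K k ε₀ U} k V U' → InUkClassB11 F N K k ε₀ U ∧ OrbitRel k U U'))
    (hUk : ∀ (V : GaugeField (F.P K) k (SU N)) (δ : ℝ), 0 < δ → δ ≤ α₁ → B * δ ≤ a → PlaqSmall δ V →
      UkExists F N K k a V ∧ InUkClassB11 F N K k a (Uk F N K k a V))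
    (h11 : ∀ V : GaugeField (F.P K) k (SU N), PlaqSmall ν.ε₀ V → UkExists F N K k a V ∧ UniqueUkOrbit F N K k a V)
    {W : GaugeField (F.P K) (k + 1) (SU N)} (hW : W ∈ domUOfRecord F N ν a ρ K (k + 1)) :
    Averaging.iter (avOfRecord F N K) k (Uk F N K (k + 1) a W) ∈ domUOfRecord F N ν a ρ K k := by
  obtain ⟨hex, hreg⟩ := firstForm_of_mem_domU hW
  have hL1 : (1 : ℝ) ≤ (F.L : ℝ) := by exact_mod_cast F.hL.2.le
  have hL2 : (1 : ℝ) ≤ (F.L : ℝ) ^ 2 := one_le_pow₀ hL1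
  have hδL : 2 * ρ ≤ ν.ε₀ * (F.L : ℝ) ^ 2 := hδ.trans (le_mul_of_one_le_right (by linarith) hL2)
  have hα₁L : 2 * ρ ≤ α₁ * (F.L : ℝ) ^ 2 := hα₁.trans (le_mul_of_one_le_right (by linarith) hL2)
  obtain ⟨hR, hQ⟩ := isBackground_restrict_and_uniqueUkOrbit_of_slots K k ha haα hρ h53a h53b hδL hα₁L hB hBρ hT1 hUk h11 hex hreg
  have hmem : Uk F N K (k + 1) a W ∈ bgReg F N K k ρ := bgReg_succ_subset hρ.le K k (hreg _ (isBackground_Uk hex))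
  exact mem_domU_of_firstForm hρ h53a h53b hδ h11 ⟨⟨_, hR⟩, fun U₁ h₁ => (mem_bgReg_iff_of_orbitRel (hQ _ _ h₁ hR)).2 hmem⟩

/-- **SELECTOR AGREEMENT DOWNWARD ON THE DOMAIN** (`a′ ≤ a`, `ρ ≤ a′`): at a member `W` the radius-`a′` selector returns the radius-`a` background (every radius-`a` minimiser is `a′`-regular; mutual
minimality, g19's L2). [cite: Balaban1985Variational, Thm 1 (6),(8) p.279; Balaban1987RG1, (1.1)–(1.2) p.260 (bookkeeping)] -/
theorem Uk_eq_of_mem_domU_of_le {ν : Stage7Numerics} {a a' ρ : ℝ} {K k : ℕ} (hle : a' ≤ a) (hρa : ρ ≤ a') {W : GaugeField (F.P K) k (SU N)}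
    (hW : W ∈ domUOfRecord F N ν a ρ K k) : Uk F N K k a W = Uk F N K k a' W := by
  obtain ⟨hex, hreg⟩ := firstForm_of_mem_domU hW
  exact (Uk_eq_of_le_of_forall_isBackground_mem hle hex fun U₁ h₁ => bgReg_mono hρa (hreg U₁ h₁)).symm

end Domain

/-! ## §3  The door with the domain pinned (`N = 2`) -/

section Door

variable (F : T4Family)

/-- ★★★ **THE DOOR «2′ ⟸ box at ONE fixed radius ā», DOMAIN SYSTEM PINNED TO THE MEMBERSHIP DOMAIN OF RECORD, RADIUS LETTER FREE INSIDE THEOREM 1's WINDOW.**  Door level: radius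
`0 < ā ≤ α₀` inside Berge's window (`ā < α`, the [B7] rows `143·256·α ≤ ⅓`, `2α ≤ 2δ_{SU(2)}∕(8L)²` and the loop guards `9L²·2α ≤ 1∕24`, `157·9L²·2α < L⁻³`); threshold `δ₁₁`; N07's FOUR
standard displayed sentences — `hT1` (Theorem 1 AT OBJECTS, every member, ceilings `α₀ α₁`, constant `B ≥ 0`), `hUk` (₈a rows at every radius `ε ∈ [ā, α₀]`), `h11` ([I] (1.1) existence ∧
uniqueness at every radius `ε ∈ [ā, α₀]` on `PlaqSmall δ₁₁`), `hI` (INTERIORITY of the closed-class minimisers at `ā` on `PlaqSmall δ₁₁`).  Per text radius `a₀ > 0` carrying the [15] antecedents,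
the producer gives `γ₀, ε₂₉, β′, ρ` with: numerics (`0 < ρ`, (53) pair, `2ρ ≤ δ₁₁`, `2ρ ≤ α₁`, `2Bρ ≤ ā`); NODE O's box `−β′ ≤ β₁₃(F; ā, ε₂₉) ≤ β′` on `]0, γ₀]` at the zero member; the
Lipschitz-(8) COLLAR row (hS) on the first form («a level-`k` field whose average is first-form at level `k+1` and at which the `ā`-cutoff (2.9) is non-zero is first-form»); the CONTINUITY row
(hT) on the plaquette ball (`{|∂V − 1| < δ₁₁} ⊆ regSetOfRecord` of the `ā`-member's β-density — N09's `hreg` species); the SELECTOR ALTERNATIVE: `a₀ ≤ ā ∧ ρ ≤ a₀` (downward — free), or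
`ā ≤ a₀ ≤ α₀` (upward inside the window — FREE, §2 `ukExists_and_regular_up_of_slots`), or `ā ≤ a₀` with the (8)-row at radius `a₀` on the first form (text radii beyond the ceiling).  THEN
`K0V23Defs.AbsBetaBoxAtThm1WitnessCCMGenGridGZBAt F`.  Proof: g19's read-set induction `…RadiusBlind.betaOfRecord₁₃_thm1CCMWZB_radiusBlind_of_readSet` on
`Û K k := if k ≤ K then domUOfRecord ⟨…, ε₀ := δ₁₁⟩ ā ρ K k else univ` (§2 supplies openness in range, `1 ∈ Û`, (hN) from (hS), (hB), selector agreement), then the letter census (`rfl`).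
CONDITIONAL on every displayed row; NO β estimate; nothing of Bałaban's asserted. [cite: Balaban1987RG1, Thm 1 p.259, Thm 3 p.264, (1.20)–(1.22) p.264, (1.1)–(1.2) p.260, p.259, (2.9) p.266; Balaban1985Variational, Thm 1 (6),(8)–(10) p.279, Prop. 7 p.299; Balaban1985Averaging, Prop. 2 (53) p.26 (bookkeeping)] -/
theorem absBetaBoxGZBAt_of_boxAtRadius_of_membershipDomain (ā δ₁₁ α₀ α₁ B α : ℝ) (hā : 0 < ā) (hāα₀ : ā ≤ α₀) (hB : 0 ≤ B)
    (hāα : ā < α) (hα3 : 143 * 256 * α ≤ 1 / 3) (hα2 : 2 * α ≤ 2 * deltaSU (Fin 2) / (8 * (F.L : ℝ)) ^ 2)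
    (hα24 : 9 * (F.L : ℝ) ^ 2 * (2 * α) ≤ 1 / 24) (hαL : 157 * (9 * (F.L : ℝ) ^ 2 * (2 * α)) < ((F.L : ℝ) ^ 3)⁻¹)
    (hT1 : ∀ (K k : ℕ) (ε₁ : ℝ), 0 < ε₁ → ε₁ ≤ α₁ → ∀ V : GaugeField (F.P K) k (Node00.SU 2), PlaqSmall ε₁ V →
      (∃ U : GaugeField (F.P K) 0 (Node00.SU 2), IsBackground (avOfRecord F 2 K) {U | InUkClassB11 F 2 K k (B * ε₁) U} k V U) ∧
      (∀ ε₀ : ℝ, B * ε₁ ≤ ε₀ → ε₀ ≤ α₀ → ∀ U U' : GaugeField (F.P K) 0 (Node00.SU 2),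
          IsBackground (avOfRecord F 2 K) {U | InUkClassB11 F 2 K k (B * ε₁) U} k V U →
          IsBackground (avOfRecord F 2 K) {U | InUkClassB11 F 2 K k ε₀ U} k V U' → InUkClassB11 F 2 K k ε₀ U ∧ OrbitRel k U U'))
    (hUk : ∀ (K k : ℕ) (ε : ℝ), ā ≤ ε → ε ≤ α₀ → ∀ (V : GaugeField (F.P K) k (Node00.SU 2)) (δ : ℝ), 0 < δ → δ ≤ α₁ → B * δ ≤ ε → PlaqSmall δ V →
      UkExists F 2 K k ε V ∧ InUkClassB11 F 2 K k ε (Uk F 2 K k ε V))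
    (h11 : ∀ (K k : ℕ) (ε : ℝ), ā ≤ ε → ε ≤ α₀ → ∀ V : GaugeField (F.P K) k (Node00.SU 2), PlaqSmall δ₁₁ V → UkExists F 2 K k ε V ∧ UniqueUkOrbit F 2 K k ε V)
    (hI : ∀ (K k : ℕ) (V : GaugeField (F.P K) k (Node00.SU 2)), PlaqSmall δ₁₁ V → ∀ U₀ : GaugeField (F.P K) 0 (Node00.SU 2),
      IsBackground (avOfRecord F 2 K) (closure (bgReg F 2 K k ā)) k V U₀ → U₀ ∈ bgReg F 2 K k ā)
    (h : ∀ a₀ : ℝ, 0 < a₀ →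
      (∃ (j c c₀ c₁ : ℕ) (B₃ B₃' a₁ : ℝ), c ≤ F.L ^ j ∧ c₀ ≤ j + 1 ∧ c₁ ≤ j ∧ 2 * (F.L : ℝ) ^ 2 ≤ B₃ ∧ 0 < B₃' ∧ 0 < a₁ ∧
        VariationalThm1RegSepCoP7MGB F 2
          (fun ν M g K k _s => c ≤ ν.M₁ ∧ k + c₀ ≤ F.m + K ∧ F.L ^ c₁ ∣ M ∧
            ∀ i, 1 ≤ i → i ≤ k → dCubeSide (F.P K).L M (RkOfRecord (F.P K).L ν.r (g i)) i ∣ (F.P K).sitesPerDir 0) (lamDatum F) (dataSmall7LamTopOf F 2) B₃ a₀ a₁ ∧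
        Gauge9RegSepTopStepGB F 2 (fun ν K Ω => suppDomOfRecord F ν K Ω) (F.L ^ j)
          (fun ν M g K k _s => c ≤ ν.M₁ ∧ k + c₀ ≤ F.m + K ∧ F.L ^ c₁ ∣ M ∧
            ∀ i, 1 ≤ i → i ≤ k → dCubeSide (F.P K).L M (RkOfRecord (F.P K).L ν.r (g i)) i ∣ (F.P K).sitesPerDir 0) (lamDatum F) (dataSmall7LamTopOf F 2) B₃ B₃' a₀ a₁) →
      ∃ (γ₀ ε₂₉ β' ρ : ℝ),
        0 < γ₀ ∧ 0 < ε₂₉ ∧ 0 < ρ ∧ 143 * 256 * ρ ≤ 1 / 3 ∧ 2 * ρ ≤ 2 * deltaSU (Fin 2) / (8 * (F.L : ℝ)) ^ 2 ∧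
        2 * ρ ≤ δ₁₁ ∧ 2 * ρ ≤ α₁ ∧ 2 * B * ρ ≤ ā ∧
        BetaLowerH (-β') γ₀ (betaOfRecord₁₃ F 2 (theta13OfThm1CCMWZB F 2 0 (1 / 2) ā 0 ε₂₉ 0 0 ā 0 (fun _ _ => 0) (fun _ _ => 0))) ∧
        BetaUpperH β' γ₀ (betaOfRecord₁₃ F 2 (theta13OfThm1CCMWZB F 2 0 (1 / 2) ā 0 ε₂₉ 0 0 ā 0 (fun _ _ => 0) (fun _ _ => 0))) ∧
        (∀ K k V, k < K →
          (UkExists F 2 K (k + 1) ā ((avOfRecord F 2 K k).avg V) ∧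
            ∀ U₁, IsBackground (avOfRecord F 2 K) (bgReg F 2 K (k + 1) ā) (k + 1) ((avOfRecord F 2 K k).avg V) U₁ → U₁ ∈ bgReg F 2 K (k + 1) ρ) →
          chiFix29OfRecord F 2 (numerics7OfThm1CCM F.L 0 0 0 0 ā 0) ε₂₉ K k V ≠ 0 →
          UkExists F 2 K k ā V ∧ ∀ U₁, IsBackground (avOfRecord F 2 K) (bgReg F 2 K k ā) k V U₁ → U₁ ∈ bgReg F 2 K k ρ) ∧
        (∀ K (g : ℕ → ℝ) k, k < K → {V : GaugeField (F.P K) (k + 1) (Node00.SU 2) | PlaqSmall δ₁₁ V} ⊆ regSetOfRecord F 2 K k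
          (integrand (chiFixed29 F 2 (numerics7OfThm1CCM F.L 0 0 0 0 ā 0) ε₂₉ K g k) (gfOfRecord F 2 K k) (g k)
            (effActionHT F 2 (TcanOfRecord F 2) (chiFixed29 F 2 (numerics7OfThm1CCM F.L 0 0 0 0 ā 0) ε₂₉) K g k))) ∧
        ((a₀ ≤ ā ∧ ρ ≤ a₀) ∨ (ā ≤ a₀ ∧ a₀ ≤ α₀) ∨
          (ā ≤ a₀ ∧ ∀ K k W, k < K →
            (UkExists F 2 K (k + 1) ā W ∧ ∀ U₁, IsBackground (avOfRecord F 2 K) (bgReg F 2 K (k + 1) ā) (k + 1) W U₁ → U₁ ∈ bgReg F 2 K (k + 1) ρ) →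
            UkExists F 2 K (k + 1) a₀ W ∧ ∀ U₁, IsBackground (avOfRecord F 2 K) (bgReg F 2 K (k + 1) a₀) (k + 1) W U₁ → U₁ ∈ bgReg F 2 K (k + 1) ā))) :
    AbsBetaBoxAtThm1WitnessCCMGenGridGZBAt F := by
  -- a threshold carrier whose `ε₀` is `δ₁₁` (no other field is read by `domUOfRecord`)
  obtain ⟨ν₁, hν⟩ : ∃ ν₁ : Stage7Numerics, ν₁.ε₀ = δ₁₁ :=
    ⟨{ M₁ := 0, M₂ := 0, r := 0, p₀ := 0, A₀ := 0, logσ₀ := 0, εreg := 0, ε₀ := δ₁₁ }, rfl⟩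
  have hα : 0 < α := hā.trans hāα
  intro j c c₀ c₁ B₃ B₃' a₀ a₁ hc hc₀ hc₁ hB₃ hB₃' ha₀ ha₁ h15 h9
  obtain ⟨γ₀, ε₂₉, β', ρ, hγ₀, hε, hρ, h53a, h53b, hδ, hα₁, hBρ, hlo, hup, hS, hT, hsel⟩ :=
    h a₀ ha₀ ⟨j, c, c₀, c₁, B₃, B₃', a₁, hc, hc₀, hc₁, hB₃, hB₃', ha₁, h15, h9⟩
  have hδν : 2 * ρ ≤ ν₁.ε₀ := hν ▸ hδ
  -- the slots at the fixed radius `ā`, on the threshold ball of `ν₁`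
  have h11ν : ∀ (K k : ℕ) (V : GaugeField (F.P K) k (Node00.SU 2)), PlaqSmall ν₁.ε₀ V → UkExists F 2 K k ā V ∧ UniqueUkOrbit F 2 K k ā V := by
    rw [hν]; exact fun K k => h11 K k ā le_rfl hāα₀
  have hUkā : ∀ (K k : ℕ) (V : GaugeField (F.P K) k (Node00.SU 2)) (δ : ℝ), 0 < δ → δ ≤ α₁ → B * δ ≤ ā → PlaqSmall δ V →
      UkExists F 2 K k ā V ∧ InUkClassB11 F 2 K k ā (Uk F 2 K k ā V) := fun K k => hUk K k ā le_rfl hāα₀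
  have hIν : ∀ (K k : ℕ) (V : GaugeField (F.P K) k (Node00.SU 2)), PlaqSmall ν₁.ε₀ V → ∀ U₀ : GaugeField (F.P K) 0 (Node00.SU 2),
      IsBackground (avOfRecord F 2 K) (closure (bgReg F 2 K k ā)) k V U₀ → U₀ ∈ bgReg F 2 K k ā := by
    rw [hν]; exact hI
  -- the domain system fed to the read-set induction: the membership domain in range, `univ` above `K`
  obtain ⟨Û, hÛ⟩ : ∃ Û : (K k : ℕ) → Set (GaugeField (F.P K) k (Node00.SU 2)),
      Û = fun K k => if k ≤ K then domUOfRecord F 2 ν₁ ā ρ K k else Set.univ := ⟨_, rfl⟩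
  have hin : ∀ K k, k ≤ K → Û K k = domUOfRecord F 2 ν₁ ā ρ K k := fun K k hk => by rw [hÛ]; exact if_pos hk
  have hout : ∀ K k, ¬ k ≤ K → Û K k = Set.univ := fun K k hk => by rw [hÛ]; exact if_neg hk
  have hUo : ∀ K k, IsOpen (Û K k) := by
    intro K k
    by_cases hk : k ≤ K
    · rw [hin K k hk]
      exact isOpen_domU_of_slots K k (hk.trans (Nat.le_add_left K F.m)) hāα hα hα3 hα2 hα24 hαL hρ h53a h53b hδν (hIν K k) fun V hV => (h11ν K k V hV).2
    · rw [hout K k hk]; exact isOpen_univ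
  have hU1 : ∀ K k, (1 : GaugeField (F.P K) k (Node00.SU 2)) ∈ Û K k := by
    intro K k
    by_cases hk : k ≤ K
    · rw [hin K k hk]; exact one_mem_domU K k hā hρ h53a h53b hδν (h11ν K k)
    · rw [hout K k hk]; exact Set.mem_univ _
  have hC : ∀ K (g : ℕ → ℝ) k, k < K → Û K (k + 1) ⊆ regSetOfRecord F 2 K k
      (integrand (chiFixed29 F 2 (numerics7OfThm1CCM F.L 0 0 0 0 ā 0) ε₂₉ K g k) (gfOfRecord F 2 K k) (g k)
        (effActionHT F 2 (TcanOfRecord F 2) (chiFixed29 F 2 (numerics7OfThm1CCM F.L 0 0 0 0 ā 0) ε₂₉) K g k)) := by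
    intro K g k hk V hV
    rw [hin K (k + 1) hk] at hV
    exact hT K g k hk (hν ▸ ((mem_domUOfRecord_iff ν₁ ā ρ K (k + 1) V).1 hV).1)
  have hN : ∀ K k V, k < K → (avOfRecord F 2 K k).avg V ∈ Û K (k + 1) →
      chiFix29OfRecord F 2 (numerics7OfThm1CCM F.L 0 0 0 0 ā 0) ε₂₉ K k V ≠ 0 → V ∈ Û K k := by
    intro K k V hk hV hz
    rw [hin K (k + 1) hk] at hV
    rw [hin K k (Nat.le_of_lt hk)]
    exact mem_domU_of_firstForm hρ h53a h53b hδν (h11ν K k) (hS K k V hk (firstForm_of_mem_domU hV) hz)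
  have hBr : ∀ K k W, k < K → W ∈ Û K (k + 1) → Averaging.iter (avOfRecord F 2 K) k (Uk F 2 K (k + 1) ā W) ∈ Û K k := by
    intro K k W hk hW
    rw [hin K (k + 1) hk] at hW
    rw [hin K k (Nat.le_of_lt hk)]
    exact iter_Uk_mem_domU K k hā hāα₀ hρ h53a h53b hδν hα₁ hB hBρ (hT1 K k) (hUkā K k) (h11ν K k) hW
  -- radius blindness ā ↦ a₀ at the zero member, on `Û`
  have heq : betaOfRecord₁₃ F 2 (theta13OfThm1CCMWZB F 2 0 (1 / 2) ā 0 ε₂₉ 0 0 ā 0 (fun _ _ => 0) (fun _ _ => 0)) =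
      betaOfRecord₁₃ F 2 (theta13OfThm1CCMWZB F 2 0 (1 / 2) a₀ 0 ε₂₉ 0 0 a₀ 0 (fun _ _ => 0) (fun _ _ => 0)) := by
    refine betaOfRecord₁₃_thm1CCMWZB_radiusBlind_of_readSet F 2 0 (1 / 2) 0 ε₂₉ 0 0 0 ā a₀ _ _ Û hUo hU1 ?_ hC hN hBr
    intro K k W hk hW
    rw [hin K (k + 1) hk] at hW
    rcases hsel with ⟨hle, hρa⟩ | ⟨hle, ha₀α⟩ | ⟨hle, h8⟩
    · exact Uk_eq_of_mem_domU_of_le hle hρa hW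
    · obtain ⟨hex', hreg'⟩ := ukExists_and_regular_up_of_slots K (k + 1) hle ha₀α hρ h53a h53b hδ hα₁ hBρ (hT1 K (k + 1))
        (hUk K (k + 1) a₀ hle ha₀α) (h11 K (k + 1) a₀ hle ha₀α) (firstForm_of_mem_domU hW)
      exact Uk_eq_of_le_of_forall_isBackground_mem hle hex' hreg'
    · obtain ⟨hex', hreg'⟩ := h8 K k W hk (firstForm_of_mem_domU hW)
      exact Uk_eq_of_le_of_forall_isBackground_mem hle hex' hreg'
  -- the letter census (`rfl`): the member the text names has the β of the zero member of the same radius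
  have hcensus : betaOfRecord₁₃ F 2 (theta13OfThm1CCMWZB F 2 j (1 / 2) a₀ a₀ ε₂₉ B₃ B₃' a₀ a₁ (fun _ _ => 0) (fun _ _ => 0)) =
      betaOfRecord₁₃ F 2 (theta13OfThm1CCMWZB F 2 0 (1 / 2) a₀ 0 ε₂₉ 0 0 a₀ 0 (fun _ _ => 0) (fun _ _ => 0)) := rfl
  refine ⟨γ₀, a₀, ε₂₉, β', hγ₀, ha₀, hε, ?_, ?_⟩
  · rw [hcensus, ← heq]; exact hlo
  · rw [hcensus, ← heq]; exact hup

end Door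

/-! ## §4  A6: the `ā`-window of §3 is an inhabited range -/

section A6

variable {F : T4Family}

/-- **BERGE's WINDOW IS INHABITED**: some `α > 0` satisfies the four door-level numerics (`143·256·α ≤ ⅓`, `2α ≤ 2δ_{SU(2)}∕(8L)²`, `9L²·2α ≤ 1∕24`, `157·9L²·2α < L⁻³`), so every
`0 < ā < α` is admissible — the door's `ā`-numerics are not an empty range (and the `ρ`-numerics are inhabited by file 1's `slotNumerics_inhabited`). [cite: Balaban1985Averaging, Prop. 2 (52)–(53) p.26 (bookkeeping)] -/
theorem openNumerics_inhabited : ∃ α : ℝ, 0 < α ∧ 143 * 256 * α ≤ 1 / 3 ∧ 2 * α ≤ 2 * deltaSU (Fin 2) / (8 * (F.L : ℝ)) ^ 2 ∧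
    9 * (F.L : ℝ) ^ 2 * (2 * α) ≤ 1 / 24 ∧ 157 * (9 * (F.L : ℝ) ^ 2 * (2 * α)) < ((F.L : ℝ) ^ 3)⁻¹ := by
  have hL1 : (1 : ℝ) ≤ (F.L : ℝ) := by exact_mod_cast F.hL.2.le
  have hL0 : (0 : ℝ) < (F.L : ℝ) := by linarith
  have hdS : 0 < deltaSU (Fin 2) := deltaSU_pos
  obtain ⟨c, hc⟩ : ∃ c : ℝ, c = deltaSU (Fin 2) / (8 * (F.L : ℝ)) ^ 2 := ⟨_, rfl⟩
  have hcpos : 0 < c := by rw [hc]; positivity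
  obtain ⟨e, he⟩ : ∃ e : ℝ, e = ((F.L : ℝ) ^ 3)⁻¹ / (2 * (157 * (9 * (F.L : ℝ) ^ 2 * 2))) := ⟨_, rfl⟩
  have hepos : 0 < e := by rw [he]; positivity
  obtain ⟨α, hα⟩ : ∃ α : ℝ, α = min (min (1 / (3 * (143 * 256))) c) (min (1 / (24 * (9 * (F.L : ℝ) ^ 2 * 2))) e) := ⟨_, rfl⟩
  have h1 : α ≤ 1 / (3 * (143 * 256)) := hα ▸ (min_le_left _ _).trans (min_le_left _ _)
  have h2 : α ≤ c := hα ▸ (min_le_left _ _).trans (min_le_right _ _)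
  have h3 : α ≤ 1 / (24 * (9 * (F.L : ℝ) ^ 2 * 2)) := hα ▸ (min_le_right _ _).trans (min_le_left _ _)
  have h4 : α ≤ e := hα ▸ (min_le_right _ _).trans (min_le_right _ _)
  have hαpos : 0 < α := by
    rw [hα]; exact lt_min (lt_min (by positivity) hcpos) (lt_min (by positivity) hepos)
  refine ⟨α, hαpos, ?_, ?_, ?_, ?_⟩
  · calc 143 * 256 * α ≤ 143 * 256 * (1 / (3 * (143 * 256))) := by gcongr
      _ = 1 / 3 := by norm_num
  · rw [mul_div_assoc, ← hc]; linarith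
  · have hpos : 0 < 24 * (9 * (F.L : ℝ) ^ 2 * 2) := by positivity
    calc 9 * (F.L : ℝ) ^ 2 * (2 * α) = (9 * (F.L : ℝ) ^ 2 * 2) * α := by ring
      _ ≤ (9 * (F.L : ℝ) ^ 2 * 2) * (1 / (24 * (9 * (F.L : ℝ) ^ 2 * 2))) := by gcongr
      _ = 1 / 24 := by field_simp
  · have hpos : 0 < 2 * (157 * (9 * (F.L : ℝ) ^ 2 * 2)) := by positivity
    calc 157 * (9 * (F.L : ℝ) ^ 2 * (2 * α)) = (157 * (9 * (F.L : ℝ) ^ 2 * 2)) * α := by ring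
      _ ≤ (157 * (9 * (F.L : ℝ) ^ 2 * 2)) * e := by gcongr
      _ = ((F.L : ℝ) ^ 3)⁻¹ / 2 := by rw [he]; field_simp
      _ < ((F.L : ℝ) ^ 3)⁻¹ := by
          have : 0 < ((F.L : ℝ) ^ 3)⁻¹ := by positivity
          linarith

end A6

end Summit.QuantumFields.YangMills.BalabanUVNodes.K0TwoPrimeOfMembershipDomain
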